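import Mathlib
import HarnessLib.Audit
import Summits.PneNP.PneNP.Theorems.PstarCoreBound

/-!
# Solvability of `𝔽₂`-linear systems and XOR elimination (ROUND-24, GAPTWO-PLAN S4, memo §11 "basis-free general form")

FRONTIER range-avoidance ladder, rung F-N3, ROUND 24 (cell `pnp-ideate`; restricted-model proof complexity — nothing here bears on
`P` versus `NP`).

The planner's basis-free form of the core problem (memo `CORE-BOUND-NOTES.md` §11) eliminates ALL XOR variables of a core: the output
equations `x_u + x_v = y_j + m_j(a)` are solvable in `x` iff the right-hand sides sum to zero around every cycle (every even subgraph) of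
the XOR multigraph.  This file supplies that step as mechanism-free linear algebra:

* `exists_solution_iff` — the finite Fredholm alternative over `𝔽₂`: a finite system `L_i(x) = c_i` (`i ∈ s`) of linear equations on
  an `𝔽₂`-module is solvable iff every DEPENDENCY `Σ_{i ∈ D} L_i = 0` (`D ⊆ s`) has `Σ_{i ∈ D} c_i = 0` (proof: induction on `s` with
  `mem_span_of_iInf_ker_le_ker`);
* `pairSystem_solvable_iff` — for XOR-pair equations `x (u j) + x (v j) = c j` the dependencies are exactly the EVEN edge sets (every
  variable met an even number of times), so the system is solvable iff `Σ_{j ∈ D} c_j = 0` for every even `D ⊆ s`;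
* `pairSystem_solvable_iff_bool` — the same with Boolean unknowns and `xor`, the form used by the `P⋆` suite (`I.eval` with
  `xorAndPred`: `z x₀ ⊕ z x₁ ⊕ (z x₂ ∧ z x₃)`);
* `mixedSystem_solvable_iff` — XOR-pair equations together with parity constraints on vertex sets (the two `W`-constraints' XOR
  reads): solvable iff the targets sum to zero over every `T`-join (memo §11: cycle equations and joins in one formula).
-/

set_option linter.dupNamespace false

open Finset

namespace Summit.PneNP.PneNP.Theorems.PstarXorElimination

/-! ## The finite Fredholm alternative over `𝔽₂` -/

section Fredholm

variable {ι V : Type*} [AddCommGroup V] [Module (ZMod 2) V]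

/-- **Finite Fredholm alternative over `𝔽₂`.**  The system `L i x = c i` (`i ∈ s`) is solvable iff every dependency among the left-hand
sides is respected by the right-hand sides. -/
theorem exists_solution_iff [DecidableEq ι] (L : ι → V →ₗ[ZMod 2] ZMod 2) (c : ι → ZMod 2) (s : Finset ι) :
    (∃ x : V, ∀ i ∈ s, L i x = c i) ↔ ∀ D ⊆ s, (∑ i ∈ D, L i) = 0 → ∑ i ∈ D, c i = 0 := by
  have zmod2_eq_zero_or_one : ∀ a : ZMod 2, a = 0 ∨ a = 1 := by decide
  constructor
  · rintro ⟨x, hx⟩ D hD hL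
    have := congrArg (fun f : V →ₗ[ZMod 2] ZMod 2 => f x) hL
    simp only [LinearMap.coe_sum, Finset.sum_apply, LinearMap.zero_apply] at this
    rw [← this]
    exact sum_congr rfl fun i hi => (hx i (hD hi)).symm
  · induction s using Finset.induction_on with
    | empty => exact fun _ => ⟨0, fun i hi => absurd hi (notMem_empty i)⟩
    | insert j t hj ih =>
      intro hdep
      obtain ⟨x₀, hx₀⟩ := ih fun D hD hL => hdep D (hD.trans (subset_insert _ _)) hL
      -- either some solution direction moves `L j`, or `L j` depends on the `L i`, `i ∈ t`
      have e0 : ∀ a b : ZMod 2, a + b = 0 → a = b := by decide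
      have e1 : ∀ a b : ZMod 2, a + b = 1 → a + 1 = b := by decide
      by_cases hfree : ∃ k : V, (∀ i ∈ t, L i k = 0) ∧ L j k ≠ 0
      · obtain ⟨k, hk, hkj⟩ := hfree
        have hkj1 : L j k = 1 := (zmod2_eq_zero_or_one _).resolve_left hkj
        rcases zmod2_eq_zero_or_one (L j x₀ + c j) with h0 | h1
        · refine ⟨x₀, fun i hi => ?_⟩
          rcases mem_insert.1 hi with rfl | hi
          · exact e0 _ _ h0
          · exact hx₀ i hi
        · refine ⟨x₀ + k, fun i hi => ?_⟩
          rcases mem_insert.1 hi with rfl | hi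
          · rw [map_add, hkj1]; exact e1 _ _ h1
          · rw [map_add, hk i hi, add_zero]; exact hx₀ i hi
      · -- dependency: `L j = Σ_{i ∈ D'} L i` for some `D' ⊆ t`
        push Not at hfree
        have hker : ⨅ i : t, LinearMap.ker (L i) ≤ LinearMap.ker (L j) := by
          intro k hk
          rw [LinearMap.mem_ker]
          rw [Submodule.mem_iInf] at hk
          exact hfree k fun i hi => by simpa using hk ⟨i, hi⟩
        haveI : Finite t := Finite.of_fintype _
        obtain ⟨a, ha⟩ := (Submodule.mem_span_range_iff_exists_fun (ZMod 2)).1 (mem_span_of_iInf_ker_le_ker hker)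
        -- the support of `a`
        set D' : Finset ι := (t.attach.filter fun i => a i = 1).map (Function.Embedding.subtype _) with hD'
        have hD't : D' ⊆ t := by
          intro i hi
          rw [hD', mem_map] at hi
          obtain ⟨i', -, rfl⟩ := hi
          exact i'.2
        have hjD' : j ∉ D' := fun h => hj (hD't h)
        have hLj : L j = ∑ i ∈ D', L i := by
          rw [← ha, hD', sum_map, sum_filter, ← Finset.univ_eq_attach]
          refine sum_congr rfl fun i _ => ?_
          rcases zmod2_eq_zero_or_one (a i) with h | h <;> simp [h]
        -- the dependency `Σ_{D' ∪ {j}} L = 0`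
        have hself : ∀ y : V →ₗ[ZMod 2] ZMod 2, y + y = 0 := fun y => by
          rw [← two_smul (ZMod 2) y, show (2 : ZMod 2) = 0 from rfl, zero_smul]
        have hdep' := hdep (insert j D') (insert_subset_insert _ hD't) (by
          rw [sum_insert hjD', hLj, hself])
        rw [sum_insert hjD'] at hdep'
        refine ⟨x₀, fun i hi => ?_⟩
        rcases mem_insert.1 hi with rfl | hi
        · -- `L j x₀ = Σ_{D'} L i x₀ = Σ_{D'} c i = c j`
          have h1 : L i x₀ = ∑ i' ∈ D', c i' := by
            rw [hLj, LinearMap.coe_sum, Finset.sum_apply]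
            exact sum_congr rfl fun i' hi' => hx₀ i' (hD't hi')
          have h2 : c i = ∑ i' ∈ D', c i' := by
            have := hdep'
            rwa [← CharTwo.sub_eq_add, sub_eq_zero] at this
          rw [h1, h2]
        · exact hx₀ i hi

end Fredholm

/-! ## XOR-pair systems -/

section Pairs

variable {n m : ℕ}

/-- The linear form `x ↦ x (u j) + x (v j)` of an XOR-pair equation. -/
def pairForm (u v : Fin m → Fin n) (j : Fin m) : (Fin n → ZMod 2) →ₗ[ZMod 2] ZMod 2 where
  toFun x := x (u j) + x (v j)
  map_add' x y := by simp only [Pi.add_apply]; abel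
  map_smul' r x := by simp only [Pi.smul_apply, smul_eq_mul, RingHom.id_apply]; ring

/-- Evaluation of the pair form. -/
theorem pairForm_apply (u v : Fin m → Fin n) (j : Fin m) (x : Fin n → ZMod 2) : pairForm u v j x = x (u j) + x (v j) := rfl

/-- The DEGREE of a variable in an edge set: the number of slot incidences. -/
def pdeg (u v : Fin m → Fin n) (D : Finset (Fin m)) (w : Fin n) : ℕ :=
  (D.filter fun j => u j = w).card + (D.filter fun j => v j = w).card

/-- A sum of pair forms vanishes iff every variable has even degree. -/
theorem sum_pairForm_eq_zero_iff (u v : Fin m → Fin n) (D : Finset (Fin m)) :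
    (∑ j ∈ D, pairForm u v j) = 0 ↔ ∀ w : Fin n, Even (pdeg u v D w) := by
  classical
  -- evaluate at the indicator vectors
  have key : ∀ w : Fin n, (∑ j ∈ D, pairForm u v j) (Pi.single w 1) = (pdeg u v D w : ZMod 2) := by
    intro w
    rw [LinearMap.coe_sum, Finset.sum_apply]
    simp only [pairForm_apply, pdeg, Nat.cast_add, card_filter, Nat.cast_sum, Nat.cast_ite, Nat.cast_one, Nat.cast_zero,
      ← sum_add_distrib]
    refine sum_congr rfl fun j _ => ?_
    by_cases h1 : u j = w <;> by_cases h2 : v j = w <;> simp [h1, h2]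
  constructor
  · intro h w
    have := key w
    rw [h, LinearMap.zero_apply] at this
    exact (ZMod.natCast_eq_zero_iff_even).1 this.symm
  · intro h
    apply LinearMap.ext
    intro x
    rw [LinearMap.zero_apply]
    -- expand `x` in the indicator basis
    have hx : x = ∑ w, x w • (Pi.single w (1 : ZMod 2) : Fin n → ZMod 2) := by
      ext w'
      simp [Finset.sum_apply, Pi.single_apply]
    rw [hx, map_sum]
    refine sum_eq_zero fun w _ => ?_
    rw [map_smul, key w, (ZMod.natCast_eq_zero_iff_even).2 (h w), smul_zero]

/-- **XOR-pair systems**: `x (u j) + x (v j) = c j` (`j ∈ s`) is solvable over `𝔽₂` iff `Σ_{j ∈ D} c j = 0` for every EVEN edge set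
`D ⊆ s` (every variable of even degree in `D`). -/
theorem pairSystem_solvable_iff (u v : Fin m → Fin n) (c : Fin m → ZMod 2) (s : Finset (Fin m)) :
    (∃ x : Fin n → ZMod 2, ∀ j ∈ s, x (u j) + x (v j) = c j) ↔
      ∀ D ⊆ s, (∀ w : Fin n, Even (pdeg u v D w)) → ∑ j ∈ D, c j = 0 := by
  classical
  have h := exists_solution_iff (pairForm u v) c s
  simp only [pairForm_apply] at h
  rw [h]
  constructor
  · intro H D hD hev
    exact H D hD ((sum_pairForm_eq_zero_iff u v D).2 hev)
  · intro H D hD hL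
    exact H D hD ((sum_pairForm_eq_zero_iff u v D).1 hL)

/-- The Boolean encoding `Bool → 𝔽₂`. -/
def b2 (b : Bool) : ZMod 2 := if b then 1 else 0

/-- `b2` turns `xor` into addition. -/
theorem b2_xor (a b : Bool) : b2 (xor a b) = b2 a + b2 b := by
  revert a b; decide

/-- `b2` is injective. -/
theorem b2_injective : Function.Injective b2 := by
  intro a b; revert a b; decide

/-- A sum of encodings vanishes iff evenly many entries are `true`. -/
theorem sum_b2_eq_zero_iff (c : Fin m → Bool) (D : Finset (Fin m)) :
    ∑ j ∈ D, b2 (c j) = 0 ↔ Even (D.filter fun j => c j = true).card := by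
  classical
  have : ∑ j ∈ D, b2 (c j) = ((D.filter fun j => c j = true).card : ZMod 2) := by
    rw [card_filter, Nat.cast_sum]
    refine sum_congr rfl fun j _ => ?_
    unfold b2
    by_cases h : c j = true <;> simp [h]
  rw [this, ZMod.natCast_eq_zero_iff_even]

/-- **XOR-pair systems, Boolean form**: `z (u j) ⊕ z (v j) = c j` (`j ∈ s`) is solvable iff every even edge set `D ⊆ s` contains an
even number of `j` with `c j = true`. -/
theorem pairSystem_solvable_iff_bool (u v : Fin m → Fin n) (c : Fin m → Bool) (s : Finset (Fin m)) :
    (∃ z : Fin n → Bool, ∀ j ∈ s, xor (z (u j)) (z (v j)) = c j) ↔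
      ∀ D ⊆ s, (∀ w : Fin n, Even (pdeg u v D w)) → Even (D.filter fun j => c j = true).card := by
  classical
  have h := pairSystem_solvable_iff u v (fun j => b2 (c j)) s
  simp only [sum_b2_eq_zero_iff] at h
  rw [← h]
  constructor
  · rintro ⟨z, hz⟩
    refine ⟨fun w => b2 (z w), fun j hj => ?_⟩
    rw [← b2_xor, hz j hj]
  · rintro ⟨x, hx⟩
    refine ⟨fun w => decide (x w = 1), fun j hj => b2_injective ?_⟩
    have hb : ∀ t : ZMod 2, b2 (decide (t = 1)) = t := by decide
    rw [b2_xor, hb, hb, hx j hj]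

/-! ## XOR-pair systems together with parity constraints on vertex sets -/

/-- The linear form `x ↦ Σ_{w ∈ U} x w` of a parity constraint on a set of variables. -/
def setForm (U : Finset (Fin n)) : (Fin n → ZMod 2) →ₗ[ZMod 2] ZMod 2 where
  toFun x := ∑ w ∈ U, x w
  map_add' x y := by simp only [Pi.add_apply, sum_add_distrib]
  map_smul' r x := by simp only [Pi.smul_apply, smul_eq_mul, RingHom.id_apply, mul_sum]

/-- Evaluation of the set form. -/
theorem setForm_apply (U : Finset (Fin n)) (x : Fin n → ZMod 2) : setForm U x = ∑ w ∈ U, x w := rfl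

/-- A sum of pair forms and set forms vanishes iff every variable is met an even number of times (slot incidences of the edges plus
memberships in the sets): the dependencies are the `T`-JOINS. -/
theorem sum_pairForm_add_sum_setForm_eq_zero_iff {κ : Type*} (u v : Fin m → Fin n) (D : Finset (Fin m)) (U : κ → Finset (Fin n))
    (T : Finset κ) : (∑ j ∈ D, pairForm u v j) + (∑ k ∈ T, setForm (U k)) = 0 ↔
      ∀ w : Fin n, Even (pdeg u v D w + (T.filter fun k => w ∈ U k).card) := by
  classical
  have key : ∀ w : Fin n, ((∑ j ∈ D, pairForm u v j) + ∑ k ∈ T, setForm (U k)) (Pi.single w 1) =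
      ((pdeg u v D w + (T.filter fun k => w ∈ U k).card : ℕ) : ZMod 2) := by
    intro w
    rw [LinearMap.add_apply, LinearMap.coe_sum, LinearMap.coe_sum, Finset.sum_apply, Finset.sum_apply]
    simp only [pairForm_apply, setForm_apply, pdeg, Nat.cast_add, card_filter, Nat.cast_sum, Nat.cast_ite, Nat.cast_one,
      Nat.cast_zero, ← sum_add_distrib]
    congr 1
    · refine sum_congr rfl fun j _ => ?_
      by_cases h1 : u j = w <;> by_cases h2 : v j = w <;> simp [h1, h2]
    · refine sum_congr rfl fun k _ => ?_
      by_cases h : w ∈ U k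
      · rw [if_pos h, sum_eq_single_of_mem w h fun w' _ hne => by simp [hne]]; simp
      · rw [if_neg h]; exact sum_eq_zero fun w' hw' => by simp [ne_of_mem_of_not_mem hw' h]
  constructor
  · intro h w
    have := key w
    rw [h, LinearMap.zero_apply] at this
    exact (ZMod.natCast_eq_zero_iff_even).1 this.symm
  · intro h
    apply LinearMap.ext
    intro x
    rw [LinearMap.zero_apply]
    have hx : x = ∑ w, x w • (Pi.single w (1 : ZMod 2) : Fin n → ZMod 2) := by
      ext w'
      simp [Finset.sum_apply, Pi.single_apply]
    rw [hx, map_sum]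
    refine sum_eq_zero fun w _ => ?_
    rw [map_smul, key w, (ZMod.natCast_eq_zero_iff_even).2 (h w), smul_zero]

/-- **XOR elimination with parity constraints** (memo §11: cycle equations and joins in one formula).  The system
`x (u j) + x (v j) = c j` (`j ∈ s`), `Σ_{w ∈ U k} x w = d k` (`k ∈ t`) is solvable over `𝔽₂` iff for every `D ⊆ s` and `T ⊆ t` meeting every
variable evenly (`D` is a `T`-join of the sets `U k`, `k ∈ T`) the targets sum to zero: `Σ_{j ∈ D} c j + Σ_{k ∈ T} d k = 0`. -/
theorem mixedSystem_solvable_iff {κ : Type*} [DecidableEq κ] (u v : Fin m → Fin n) (c : Fin m → ZMod 2) (s : Finset (Fin m))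
    (U : κ → Finset (Fin n)) (d : κ → ZMod 2) (t : Finset κ) :
    (∃ x : Fin n → ZMod 2, (∀ j ∈ s, x (u j) + x (v j) = c j) ∧ ∀ k ∈ t, ∑ w ∈ U k, x w = d k) ↔
      ∀ D ⊆ s, ∀ T ⊆ t, (∀ w : Fin n, Even (pdeg u v D w + (T.filter fun k => w ∈ U k).card)) →
        ∑ j ∈ D, c j + ∑ k ∈ T, d k = 0 := by
  classical
  -- one system indexed by `Fin m ⊕ κ`
  let L : Fin m ⊕ κ → (Fin n → ZMod 2) →ₗ[ZMod 2] ZMod 2 := fun i => Sum.elim (pairForm u v) (fun k => setForm (U k)) i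
  let e : Fin m ⊕ κ → ZMod 2 := fun i => Sum.elim c d i
  have h := exists_solution_iff L e (s.disjSum t)
  have hsol : (∃ x : Fin n → ZMod 2, (∀ j ∈ s, x (u j) + x (v j) = c j) ∧ ∀ k ∈ t, ∑ w ∈ U k, x w = d k) ↔
      ∃ x, ∀ i ∈ s.disjSum t, L i x = e i := by
    constructor
    · rintro ⟨x, h1, h2⟩
      refine ⟨x, fun i hi => ?_⟩
      rcases i with j | k
      · exact h1 j (Finset.inl_mem_disjSum.1 hi)
      · exact h2 k (Finset.inr_mem_disjSum.1 hi)
    · rintro ⟨x, hx⟩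
      exact ⟨x, fun j hj => hx (Sum.inl j) (Finset.inl_mem_disjSum.2 hj), fun k hk => hx (Sum.inr k) (Finset.inr_mem_disjSum.2 hk)⟩
  rw [hsol, h]
  constructor
  · intro H D hD T hT hev
    have := H ((D.disjSum T)) (Finset.disjSum_mono hD hT) (by
      rw [Finset.sum_disjSum]
      exact (sum_pairForm_add_sum_setForm_eq_zero_iff u v D U T).2 hev)
    rwa [Finset.sum_disjSum] at this
  · intro H E hE hL
    -- split `E` into its two parts
    obtain ⟨D, T, rfl⟩ : ∃ D T, E = D.disjSum T :=
      ⟨E.toLeft, E.toRight, (Finset.toLeft_disjSum_toRight).symm⟩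
    have hD : D ⊆ s := fun j hj => Finset.inl_mem_disjSum.1 (hE (Finset.inl_mem_disjSum.2 hj))
    have hT : T ⊆ t := fun k hk => Finset.inr_mem_disjSum.1 (hE (Finset.inr_mem_disjSum.2 hk))
    rw [Finset.sum_disjSum] at hL ⊢
    exact H D hD T hT ((sum_pairForm_add_sum_setForm_eq_zero_iff u v D U T).1 hL)

end Pairs

end Summit.PneNP.PneNP.Theorems.PstarXorElimination
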